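import Mathlib
import Literature.Computability.Complexity.SignDegreeSimple
import HarnessLib

/-!
# The XOR lemma for polynomial threshold degree (O'Donnell–Servedio)

**Theorem 3.1** [O'Donnell–Servedio, Combinatorica 30 (2010) §3; STOC 2003].  «Let `f` and `g` be Boolean
functions on disjoint sets of variables. Then `thr(f ⊕ g) = thr(f) + thr(g)`», where `thr` is the polynomial
threshold degree (= strong degree / sign-degree, `SignDegLE` of file `SignDegreeSimple`).  **Corollary 3.2**:
«`thr(⊕_k f) = k·thr(f)`.  This corollary thus includes Minsky and Papert's lower bound of `n` for the parity
function as a special case.»  Proof as printed: the upper bound multiplies strong representations; for the lower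
bound, by the Theorem of the Alternative (ibid. Thm. 2.5/2.6 = Aspnes–Beigel–Furst–Rudich duality, here
`exists_fooling_of_not_signDegLE`) `f` has a distribution `φ` with zero correlation to every monomial of degree
`< thr f`, likewise `ψ` for `g`; the product `φ × ψ` pairs to zero with every monomial of degree
`< thr f + thr g` against `f ⊕ g` (a monomial `S = A ⊔ B` with `|A| < thr f` or `|B| < thr g`), while a strong
representation of `f ⊕ g` pairs strictly positively with it — so no strong representation of degree
`< thr f + thr g` exists.

In the `SignDegLE d` language (no `thr` function is introduced): `SignDegLE.xorPred` (degrees add),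
`not_signDegLE_xorPred_of_fooling` (the pairing argument from given fooling distributions) and
`not_signDegLE_xorPred` (`¬ SignDegLE d₁ f → ¬ SignDegLE d₂ g → ¬ SignDegLE (d₁ + d₂ + 1) (f ⊕ g)`).
Instances recorded for the range-avoidance predicates: the dictator `x ↦ x₀` and `AND₂` have sign-degree exactly
`1`, hence (XOR lemma) `XOR₂` and `IP₂ = x₀x₁ ⊕ x₂x₃` have sign-degree exactly `2`, `PARITY₃` exactly `3`
(Minsky–Papert), and the TSA/MST predicate shape `x₀ ⊕ x₁ ⊕ x₂x₃` exactly `3`; and Cor. 3.2 in general: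
`parityPred k` (`PARITY_k`) has sign-degree exactly `k` and `ipPred t` (`IP_t`, `t` disjoint `AND₂`s) exactly `t`
(`signDegLE_parityPred`/`not_signDegLE_parityPred`, `signDegLE_ipPred`/`not_signDegLE_ipPred`).

## References
* R. O'Donnell, R. A. Servedio, *New degree bounds for polynomial threshold functions*, Combinatorica 30(3)
  (2010) 327–358 (STOC 2003), §2.3 (Thm. 2.5/2.6), §3 (Thm. 3.1, Cor. 3.2). bib `OdonnellServedio2010`.
* J. Aspnes, R. Beigel, M. Furst, S. Rudich, *The expressive power of voting polynomials*, Combinatorica 14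
  (1994) (the duality). bib `AspnesEtAl1994`.
* M. Minsky, S. Papert, *Perceptrons* (1969) (parity has threshold degree `n`).
-/

namespace Literature.Computability.Complexity

open Finset

section XorLemma

variable {a b : ℕ}

/-- The XOR of a predicate on the first `a` variables and a predicate on the last `b` variables
(«Boolean functions on disjoint sets of variables»). [cite: OdonnellServedio2010, §3 (Thm. 3.1)] -/
def xorPred (f : (Fin a → Bool) → Bool) (g : (Fin b → Bool) → Bool) : (Fin (a + b) → Bool) → Bool :=
  fun u => xor (f fun i => u (Fin.castAdd b i)) (g fun j => u (Fin.natAdd a j))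

/-- The first `a` coordinates of a point of the `(a+b)`-cube. [folklore] -/
def leftPart (u : Fin (a + b) → Bool) : Fin a → Bool := fun i => u (Fin.castAdd b i)

/-- The last `b` coordinates of a point of the `(a+b)`-cube. [folklore] -/
def rightPart (u : Fin (a + b) → Bool) : Fin b → Bool := fun j => u (Fin.natAdd a j)

/-- `(f ⊕ g)(u) = f(x) ⊕ g(y)` for `u = (x, y)`. [cite: OdonnellServedio2010, §3 (Thm. 3.1)] -/
theorem xorPred_apply (f : (Fin a → Bool) → Bool) (g : (Fin b → Bool) → Bool) (u : Fin (a + b) → Bool) :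
    xorPred f g u = xor (f (leftPart u)) (g (rightPart u)) := rfl

/-- The `x`-part `A = S ∩ [a]` of a monomial `S ⊆ [a+b]`. [folklore] -/
def leftSet (S : Finset (Fin (a + b))) : Finset (Fin a) := (S.map finSumFinEquiv.symm.toEmbedding).toLeft

/-- The `y`-part `B` of a monomial `S ⊆ [a+b]` (shifted back to `[b]`). [folklore] -/
def rightSet (S : Finset (Fin (a + b))) : Finset (Fin b) := (S.map finSumFinEquiv.symm.toEmbedding).toRight

/-- `(−1)^{p ⊕ q} = (−1)^p (−1)^q`. [folklore] -/
private theorem bsgn_xor (p q : Bool) : bsgn (xor p q) = bsgn p * bsgn q := by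
  cases p <;> cases q <;> simp [bsgn]

/-- `|A| + |B| = |S|` for the split `S = A ⊔ B`. [cite: OdonnellServedio2010, Thm. 3.1 (proof)] -/
theorem card_leftSet_add_card_rightSet (S : Finset (Fin (a + b))) :
    (leftSet S).card + (rightSet S).card = S.card := by
  unfold leftSet rightSet
  rw [Finset.card_toLeft_add_card_toRight, Finset.card_map]

/-- `χ_S(x, y) = χ_A(x)·χ_B(y)` for the split `S = A ⊔ B`. [cite: OdonnellServedio2010, Thm. 3.1 (proof)] -/
theorem chiQ_eq_leftSet_mul_rightSet (S : Finset (Fin (a + b))) (u : Fin (a + b) → Bool) :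
    chiQ S u = chiQ (leftSet S) (leftPart u) * chiQ (rightSet S) (rightPart u) := by
  unfold chiQ leftSet rightSet leftPart rightPart
  have h1 : (∏ i ∈ S, bsgn (u i)) =
      ∏ z ∈ S.map finSumFinEquiv.symm.toEmbedding, bsgn (u (finSumFinEquiv z)) := by
    rw [Finset.prod_map]
    exact Finset.prod_congr rfl fun i _ => by simp
  rw [h1, Finset.prod_sum_eq_prod_toLeft_mul_prod_toRight]
  simp

/-- The split `S ↦ (A, B)` is a bijection between monomials on `[a+b]` and pairs of monomials.
[cite: OdonnellServedio2010, Thm. 3.1 (proof)] -/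
def splitSet : Finset (Fin (a + b)) ≃ Finset (Fin a) × Finset (Fin b) :=
  (finSumFinEquiv.symm.finsetCongr).trans Finset.sumEquiv.toEquiv

/-- `splitSet S = (leftSet S, rightSet S)`. [cite: OdonnellServedio2010, Thm. 3.1 (proof)] -/
theorem splitSet_apply (S : Finset (Fin (a + b))) : splitSet S = (leftSet S, rightSet S) := rfl

/-- The cube `{0,1}^{a+b}` as pairs `(x, y)`. [folklore] -/
def splitCube : (Fin (a + b) → Bool) ≃ (Fin a → Bool) × (Fin b → Bool) :=
  (finSumFinEquiv.symm.arrowCongr (Equiv.refl Bool)).trans (Equiv.sumArrowEquivProdArrow _ _ _)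

/-- `splitCube u = (leftPart u, rightPart u)`. [folklore] -/
private theorem splitCube_apply (u : Fin (a + b) → Bool) : splitCube u = (leftPart u, rightPart u) := by
  ext i <;> simp [splitCube, leftPart, rightPart, Equiv.arrowCongr]

/-- A sum over the `(a+b)`-cube of a function of `(leftPart, rightPart)` is a double sum. [folklore] -/
private theorem sum_cube_split (F : (Fin a → Bool) → (Fin b → Bool) → ℚ) :
    ∑ u : Fin (a + b) → Bool, F (leftPart u) (rightPart u) = ∑ x : Fin a → Bool, ∑ y : Fin b → Bool, F x y := by
  rw [← Fintype.sum_prod_type']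
  exact Fintype.sum_equiv splitCube _ _ fun u => by rw [splitCube_apply]

/-- **XOR lemma, upper bound** [O'Donnell–Servedio Thm. 3.1, «the upper bound is easy»]: the product of strong
representations of `f` (degree `≤ d₁`) and `g` (degree `≤ d₂`) strongly represents `f ⊕ g` with degree
`≤ d₁ + d₂`. [cite: OdonnellServedio2010, Thm. 3.1] -/
theorem SignDegLE.xorPred {d₁ d₂ : ℕ} {f : (Fin a → Bool) → Bool} {g : (Fin b → Bool) → Bool}
    (hf : SignDegLE d₁ f) (hg : SignDegLE d₂ g) : SignDegLE (d₁ + d₂) (xorPred f g) := by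
  classical
  obtain ⟨c, hc, hcpos⟩ := hf
  obtain ⟨e, he, hepos⟩ := hg
  refine ⟨fun S => c (leftSet S) * e (rightSet S), fun S hS => ?_, fun u => ?_⟩
  · -- support: |S| > d₁ + d₂ ⇒ |A| > d₁ or |B| > d₂
    show c (leftSet S) * e (rightSet S) = 0
    have hsum := card_leftSet_add_card_rightSet S
    by_cases hA : d₁ < (leftSet S).card
    · rw [hc _ hA, zero_mul]
    · have hB : d₂ < (rightSet S).card := by omega
      rw [he _ hB, mul_zero]
  · -- value: Σ_S c_A e_B χ_S(u) = p_f(x) · p_g(y)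
    have hval : (∑ S : Finset (Fin (a + b)), c (leftSet S) * e (rightSet S) * chiQ S u) =
        (∑ A : Finset (Fin a), c A * chiQ A (leftPart u)) * ∑ B : Finset (Fin b), e B * chiQ B (rightPart u) := by
      rw [Finset.sum_mul_sum, ← Finset.sum_product', Finset.univ_product_univ]
      refine Fintype.sum_equiv splitSet _ _ fun S => ?_
      rw [splitSet_apply, chiQ_eq_leftSet_mul_rightSet]; ring
    rw [hval]
    have hx := hcpos (leftPart u)
    have hy := hepos (rightPart u)
    show 0 < bsgn (xor (f (leftPart u)) (g (rightPart u))) * _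
    rw [bsgn_xor]
    calc (0 : ℚ) < (bsgn (f (leftPart u)) * ∑ A, c A * chiQ A (leftPart u)) *
          (bsgn (g (rightPart u)) * ∑ B, e B * chiQ B (rightPart u)) := mul_pos hx hy
      _ = _ := by ring

/-- **XOR lemma, lower bound — the pairing argument** [O'Donnell–Servedio Thm. 3.1, proof]: if `φ` has zero
correlation with `f·χ_A` for all `|A| ≤ d₁` and `ψ` with `g·χ_B` for all `|B| ≤ d₂` (the distributions of the
Theorem of the Alternative, ibid. Thm. 2.6), then `f ⊕ g` has no strong representation of degree `≤ d₁ + d₂ + 1`: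
`φ × ψ` annihilates every such monomial against `f ⊕ g` (a monomial `S = A ⊔ B` of size `≤ d₁ + d₂ + 1` has
`|A| ≤ d₁` or `|B| ≤ d₂`), yet pairs strictly positively with a strong representation.
[cite: OdonnellServedio2010, Thm. 3.1 (proof) with Thm. 2.6] -/
theorem not_signDegLE_xorPred_of_fooling {d₁ d₂ : ℕ} {f : (Fin a → Bool) → Bool}
    {g : (Fin b → Bool) → Bool} (φ : CubeDist a) (hφ : ∀ S, S.card ≤ d₁ → corr φ f S = 0)
    (ψ : CubeDist b) (hψ : ∀ S, S.card ≤ d₂ → corr ψ g S = 0) :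
    ¬ SignDegLE (d₁ + d₂ + 1) (xorPred f g) := by
  classical
  rintro ⟨c, hc, hpos⟩
  -- the pairing Z = Σ_u φ(x)ψ(y) · [bsgn((f⊕g)(u)) · p(u)]
  set p : (Fin (a + b) → Bool) → ℚ := fun u => ∑ S, c S * chiQ S u with hp
  set Z : ℚ := ∑ u : Fin (a + b) → Bool,
    (φ.wt (leftPart u) * ψ.wt (rightPart u)) * (bsgn (xorPred f g u) * p u) with hZ
  -- (1) Z > 0
  have hZpos : 0 < Z := by
    obtain ⟨x₀, hx₀⟩ : ∃ x, 0 < φ.wt x := by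
      by_contra h
      push Not at h
      have : (∑ x, φ.wt x) ≤ 0 := Finset.sum_nonpos fun x _ => h x
      linarith [φ.total]
    obtain ⟨y₀, hy₀⟩ : ∃ y, 0 < ψ.wt y := by
      by_contra h
      push Not at h
      have : (∑ y, ψ.wt y) ≤ 0 := Finset.sum_nonpos fun y _ => h y
      linarith [ψ.total]
    set u₀ : Fin (a + b) → Bool := splitCube.symm (x₀, y₀) with hu₀
    have hu₀' : leftPart u₀ = x₀ ∧ rightPart u₀ = y₀ := by
      have := splitCube_apply u₀
      rw [hu₀, Equiv.apply_symm_apply] at this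
      exact ⟨(Prod.mk.inj this).1.symm, (Prod.mk.inj this).2.symm⟩
    have hterm : ∀ u, 0 ≤ (φ.wt (leftPart u) * ψ.wt (rightPart u)) * (bsgn (xorPred f g u) * p u) :=
      fun u => mul_nonneg (mul_nonneg (φ.nonneg _) (ψ.nonneg _)) (hpos u).le
    have h0 : 0 < (φ.wt (leftPart u₀) * ψ.wt (rightPart u₀)) * (bsgn (xorPred f g u₀) * p u₀) := by
      rw [hu₀'.1, hu₀'.2]
      exact mul_pos (mul_pos hx₀ hy₀) (hpos u₀)
    exact lt_of_lt_of_le h0 (Finset.single_le_sum (fun u _ => hterm u) (Finset.mem_univ u₀))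
  -- (2) Z = Σ_S c_S · corr φ f A · corr ψ g B = 0
  have hZ0 : Z = 0 := by
    have hexp : Z = ∑ S, c S * (corr φ f (leftSet S) * corr ψ g (rightSet S)) := by
      -- expand p and swap sums
      have h1 : Z = ∑ u : Fin (a + b) → Bool, ∑ S, c S *
          ((φ.wt (leftPart u) * (bsgn (f (leftPart u)) * chiQ (leftSet S) (leftPart u))) *
           (ψ.wt (rightPart u) * (bsgn (g (rightPart u)) * chiQ (rightSet S) (rightPart u)))) := by
        refine Finset.sum_congr rfl fun u _ => ?_
        rw [hp]
        simp only [Finset.mul_sum]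
        refine Finset.sum_congr rfl fun S _ => ?_
        rw [chiQ_eq_leftSet_mul_rightSet]
        simp only [xorPred_apply, bsgn_xor]
        ring
      rw [h1, Finset.sum_comm]
      refine Finset.sum_congr rfl fun S _ => ?_
      rw [← Finset.mul_sum, corr, corr, Finset.sum_mul_sum]
      congr 1
      exact sum_cube_split (fun x y => (φ.wt x * (bsgn (f x) * chiQ (leftSet S) x)) *
        (ψ.wt y * (bsgn (g y) * chiQ (rightSet S) y)))
    rw [hexp]
    refine Finset.sum_eq_zero fun S _ => ?_
    by_cases hS : d₁ + d₂ + 1 < S.card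
    · rw [hc S hS, zero_mul]
    · have hsum := card_leftSet_add_card_rightSet S
      by_cases hA : (leftSet S).card ≤ d₁
      · rw [hφ _ hA, zero_mul, mul_zero]
      · have hB : (rightSet S).card ≤ d₂ := by omega
        rw [hψ _ hB, mul_zero, mul_zero]
  exact absurd hZ0 (ne_of_gt hZpos)

/-- **XOR lemma, lower bound** [O'Donnell–Servedio Thm. 3.1]: if `f` has no strong representation of degree
`≤ d₁` and `g` none of degree `≤ d₂`, then `f ⊕ g` has none of degree `≤ d₁ + d₂ + 1`; with the upper bound,
`thr(f ⊕ g) = thr(f) + thr(g)`. [cite: OdonnellServedio2010, Thm. 3.1] -/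
theorem not_signDegLE_xorPred {d₁ d₂ : ℕ} {f : (Fin a → Bool) → Bool} {g : (Fin b → Bool) → Bool}
    (hf : ¬ SignDegLE d₁ f) (hg : ¬ SignDegLE d₂ g) : ¬ SignDegLE (d₁ + d₂ + 1) (xorPred f g) := by
  obtain ⟨φ, hφ⟩ := exists_fooling_of_not_signDegLE hf
  obtain ⟨ψ, hψ⟩ := exists_fooling_of_not_signDegLE hg
  exact not_signDegLE_xorPred_of_fooling φ hφ ψ hψ

end XorLemma

/-! ### Instances: dictator, `AND₂`, `XOR₂`, `IP₂`, `PARITY₃`, `x₀ ⊕ x₁ ⊕ x₂x₃` -/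

section Instances

/-- A non-constant predicate has no strong representation of degree `0` (a nonzero constant has one sign).
[cite: OdonnellServedio2010, §2.1] -/
theorem not_signDegLE_zero_of_ne {k : ℕ} {P : (Fin k → Bool) → Bool} {u v : Fin k → Bool}
    (huv : P u ≠ P v) : ¬ SignDegLE 0 P := by
  classical
  rintro ⟨c, hc, hpos⟩
  have hconst : ∀ w, (∑ S : Finset (Fin k), c S * chiQ S w) = c ∅ := by
    intro w
    rw [Finset.sum_eq_single ∅]
    · simp [chiQ]
    · intro S _ hS
      rw [hc S (Finset.card_pos.2 (Finset.nonempty_iff_ne_empty.2 hS)), zero_mul]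
    · intro h; exact (h (Finset.mem_univ _)).elim
  have hu := hpos u
  have hv := hpos v
  rw [hconst] at hu hv
  revert hu hv huv
  cases P u <;> cases P v <;> simp [bsgn] <;> intros <;> linarith

/-- The dictator predicate `u ↦ u₀` on one variable. [folklore] -/
def dictPred : (Fin 1 → Bool) → Bool := fun u => u 0

/-- `AND₂`. [folklore] -/
def andPred₂ : (Fin 2 → Bool) → Bool := fun u => u 0 && u 1

/-- The dictator has sign-degree `≤ 1` (`χ_{0}` represents it). [cite: OdonnellServedio2010, §2.1] -/
theorem signDegLE_one_dictPred : SignDegLE 1 dictPred := by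
  classical
  refine ⟨fun S => if S = {0} then 1 else 0, fun S hS => ?_, fun u => ?_⟩
  · have h1 : S ≠ {0} := by rintro rfl; simp at hS
    simp [h1]
  · simp only [ite_mul, one_mul, zero_mul, Finset.sum_ite_eq', Finset.mem_univ, if_true]
    simp only [dictPred, chiQ, Finset.prod_singleton]
    cases u 0 <;> simp [bsgn]

/-- The dictator is not constant: sign-degree exactly `1`. [cite: OdonnellServedio2010, §2.1] -/
theorem not_signDegLE_zero_dictPred : ¬ SignDegLE 0 dictPred :=
  not_signDegLE_zero_of_ne (u := fun _ => true) (v := fun _ => false) (by simp [dictPred])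

/-- `AND₂` has sign-degree `≤ 1`: `1 + χ_{0} + χ_{1}` (i.e. `1 + (−1)^{u₀} + (−1)^{u₁}`) strongly represents
it. [cite: OdonnellServedio2010, §2.1 (halfspaces have threshold degree 1)] -/
theorem signDegLE_one_andPred₂ : SignDegLE 1 andPred₂ := by
  classical
  refine ⟨fun S => (if S = ∅ then 1 else 0) + (if S = {0} then 1 else 0) + (if S = {1} then 1 else 0),
    fun S hS => ?_, fun u => ?_⟩
  · have h0 : S ≠ ∅ := by rintro rfl; simp at hS
    have h1 : S ≠ {0} := by rintro rfl; simp at hS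
    have h2 : S ≠ {1} := by rintro rfl; simp at hS
    simp [h0, h1, h2]
  · have hval : (∑ S : Finset (Fin 2), ((if S = ∅ then (1 : ℚ) else 0) + (if S = {0} then 1 else 0) +
        (if S = {1} then 1 else 0)) * chiQ S u) = 1 + bsgn (u 0) + bsgn (u 1) := by
      simp only [add_mul, Finset.sum_add_distrib, ite_mul, one_mul, zero_mul, Finset.sum_ite_eq',
        Finset.mem_univ, if_true]
      simp [chiQ]
    rw [hval]
    simp only [andPred₂]
    cases u 0 <;> cases u 1 <;> norm_num [bsgn]

/-- `AND₂` is not constant: sign-degree exactly `1`. [cite: OdonnellServedio2010, §2.1] -/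
theorem not_signDegLE_zero_andPred₂ : ¬ SignDegLE 0 andPred₂ :=
  not_signDegLE_zero_of_ne (u := fun _ => true) (v := fun _ => false) (by simp [andPred₂])

/-- `XOR₂ = x₀ ⊕ x₁` as an `xorPred`. [cite: OdonnellServedio2010, Cor. 3.2] -/
def xorPred₂ : (Fin (1 + 1) → Bool) → Bool := xorPred dictPred dictPred

/-- **`XOR₂` has sign-degree exactly `2`** (`thr(x₀ ⊕ x₁) = 1 + 1`). [cite: OdonnellServedio2010, Cor. 3.2] -/
theorem signDeg_xorPred₂ : SignDegLE 2 xorPred₂ ∧ ¬ SignDegLE 1 xorPred₂ :=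
  ⟨signDegLE_one_dictPred.xorPred signDegLE_one_dictPred,
   not_signDegLE_xorPred not_signDegLE_zero_dictPred not_signDegLE_zero_dictPred⟩

/-- `PARITY₃ = x₀ ⊕ x₁ ⊕ x₂`. [cite: OdonnellServedio2010, Cor. 3.2] -/
def parityPred₃ : (Fin (1 + 1 + 1) → Bool) → Bool := xorPred xorPred₂ dictPred

/-- **`PARITY₃` has sign-degree exactly `3`** (Minsky–Papert for `n = 3`, via Cor. 3.2).
[cite: OdonnellServedio2010, Cor. 3.2] -/
theorem signDeg_parityPred₃ : SignDegLE 3 parityPred₃ ∧ ¬ SignDegLE 2 parityPred₃ :=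
  ⟨signDeg_xorPred₂.1.xorPred signDegLE_one_dictPred,
   not_signDegLE_xorPred signDeg_xorPred₂.2 not_signDegLE_zero_dictPred⟩

/-- `IP₂ = x₀x₁ ⊕ x₂x₃` (inner product mod 2 on two pairs). [cite: OdonnellServedio2010, Cor. 3.2] -/
def ipPred₂ : (Fin (2 + 2) → Bool) → Bool := xorPred andPred₂ andPred₂

/-- **`IP₂` has sign-degree exactly `2`** (`thr(⊕₂ AND₂) = 2·thr(AND₂)`). [cite: OdonnellServedio2010, Cor. 3.2] -/
theorem signDeg_ipPred₂ : SignDegLE 2 ipPred₂ ∧ ¬ SignDegLE 1 ipPred₂ :=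
  ⟨signDegLE_one_andPred₂.xorPred signDegLE_one_andPred₂,
   not_signDegLE_xorPred not_signDegLE_zero_andPred₂ not_signDegLE_zero_andPred₂⟩

/-- The TSA/MST-shaped predicate `x₀ ⊕ x₁ ⊕ x₂x₃` (the `4`-local «P⋆» of the range-avoidance literature;
`P_MST06 = x₁+x₂+x₃+x₄x₅` has one more linear term). [cite: OdonnellServedio2010, Thm. 3.1] -/
def xorAndPred : (Fin (1 + 1 + 2) → Bool) → Bool := xorPred xorPred₂ andPred₂

/-- **`x₀ ⊕ x₁ ⊕ x₂x₃` has sign-degree exactly `3`** (`= thr(x₀) + thr(x₁) + thr(x₂x₃)`).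
[cite: OdonnellServedio2010, Thm. 3.1] -/
theorem signDeg_xorAndPred : SignDegLE 3 xorAndPred ∧ ¬ SignDegLE 2 xorAndPred :=
  ⟨signDeg_xorPred₂.1.xorPred signDegLE_one_andPred₂,
   not_signDegLE_xorPred signDeg_xorPred₂.2 not_signDegLE_zero_andPred₂⟩

/-- Pointwise form of `xorAndPred` on `{0,1}⁴`. [cite: OdonnellServedio2010, Thm. 3.1] -/
theorem xorAndPred_apply (u : Fin 4 → Bool) :
    xorAndPred u = xor (xor (u 0) (u 1)) (u 2 && u 3) := rfl

/-- Pointwise form of `ipPred₂` on `{0,1}⁴`. [cite: OdonnellServedio2010, Cor. 3.2] -/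
theorem ipPred₂_apply (u : Fin 4 → Bool) : ipPred₂ u = xor (u 0 && u 1) (u 2 && u 3) := rfl

/-! ### Corollary 3.2: `k`-fold XORs — `PARITY_k` and `IP_t` for every `k`, `t` -/

/-- `PARITY_k = x₀ ⊕ ⋯ ⊕ x_{k−1}` as an iterated `xorPred` of dictators (`PARITY₀ ≡ false`).
[cite: OdonnellServedio2010, Cor. 3.2] -/
def parityPred : (k : ℕ) → (Fin k → Bool) → Bool
  | 0 => fun _ => false
  | k + 1 => xorPred (parityPred k) dictPred

/-- `IP_t = x₀x₁ ⊕ x₂x₃ ⊕ ⋯ ⊕ x_{2t−2}x_{2t−1}` as an iterated `xorPred` of `AND₂`s (`IP₀ ≡ false`).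
[cite: OdonnellServedio2010, Cor. 3.2] -/
def ipPred : (t : ℕ) → (Fin (2 * t) → Bool) → Bool
  | 0 => fun _ => false
  | t + 1 => xorPred (ipPred t) andPred₂

/-- A constant predicate has sign-degree `0`. [cite: OdonnellServedio2010, §2.1] -/
theorem signDegLE_zero_const {k : ℕ} (b : Bool) : SignDegLE 0 (fun _ : Fin k → Bool => b) := by
  classical
  refine ⟨fun S => if S = ∅ then bsgn b else 0, fun S hS => ?_, fun u => ?_⟩
  · have h : S ≠ ∅ := by rintro rfl; simp at hS
    simp [h]
  · simp only [ite_mul, zero_mul, Finset.sum_ite_eq', Finset.mem_univ, if_true]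
    simp only [chiQ, Finset.prod_empty, mul_one]
    cases b <;> simp [bsgn]

/-- **`thr(PARITY_k) ≤ k`**: the `k`-fold product of dictator representations. [cite: OdonnellServedio2010, Cor. 3.2] -/
theorem signDegLE_parityPred : ∀ k, SignDegLE k (parityPred k)
  | 0 => signDegLE_zero_const false
  | k + 1 => (signDegLE_parityPred k).xorPred signDegLE_one_dictPred

/-- **`thr(PARITY_{k+1}) > k`** (Minsky–Papert: parity on `n` variables has threshold degree `n`; here as
`k`-fold XOR lemma). [cite: OdonnellServedio2010, Cor. 3.2] -/
theorem not_signDegLE_parityPred : ∀ k, ¬ SignDegLE k (parityPred (k + 1))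
  | 0 => not_signDegLE_zero_of_ne (P := parityPred 1) (u := fun _ => true) (v := fun _ => false) (by decide)
  | k + 1 => not_signDegLE_xorPred (not_signDegLE_parityPred k) not_signDegLE_zero_dictPred

/-- **`thr(IP_t) ≤ t`**. [cite: OdonnellServedio2010, Cor. 3.2] -/
theorem signDegLE_ipPred : ∀ t, SignDegLE t (ipPred t)
  | 0 => signDegLE_zero_const false
  | t + 1 => (signDegLE_ipPred t).xorPred signDegLE_one_andPred₂

/-- **`thr(IP_{t+1}) > t`**: inner product mod 2 on `t+1` disjoint pairs has sign-degree exactly `t+1`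
(a cycle-sum of `t+1` disjoint AND-monomials). [cite: OdonnellServedio2010, Cor. 3.2] -/
theorem not_signDegLE_ipPred : ∀ t, ¬ SignDegLE t (ipPred (t + 1))
  | 0 => not_signDegLE_zero_of_ne (P := ipPred 1) (u := fun _ => true) (v := fun _ => false) (by decide)
  | t + 1 => not_signDegLE_xorPred (not_signDegLE_ipPred t) not_signDegLE_zero_andPred₂

/-- The AIK/GGNS-encoded gate `x₀x₁ ⊕ x₂` (a degree-2 monomial masked by a fresh bit — the `NC⁰₃` tables of the
degree-2 → `NC⁰₃` reduction). [cite: OdonnellServedio2010, Thm. 3.1] -/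
def andXorPred : (Fin (2 + 1) → Bool) → Bool := xorPred andPred₂ dictPred

/-- **`x₀x₁ ⊕ x₂` has sign-degree exactly `2`** (`= thr(AND₂) + thr(x₂)`). [cite: OdonnellServedio2010, Thm. 3.1] -/
theorem signDeg_andXorPred : SignDegLE 2 andXorPred ∧ ¬ SignDegLE 1 andXorPred :=
  ⟨signDegLE_one_andPred₂.xorPred signDegLE_one_dictPred,
   not_signDegLE_xorPred not_signDegLE_zero_andPred₂ not_signDegLE_zero_dictPred⟩

/-- Pointwise form of `andXorPred` on `{0,1}³`. [cite: OdonnellServedio2010, Thm. 3.1] -/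
theorem andXorPred_apply (u : Fin 3 → Bool) : andXorPred u = xor (u 0 && u 1) (u 2) := rfl

end Instances

end Literature.Computability.Complexity
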